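import Literature.IUT.LogThetaLattice.PacketLogVolumes
import Literature.AnabelianGeometry.AbsoluteAnabelian.LocalVolumesArchimedeanProofs
import HarnessLib

/-!
# [IUTchIII] Proposition 3.9 (iv) (b) "log-link compatibility" at an ARCHIMEDEAN place, over the genuine
# complex exponential / principal logarithm — proof-only companion of `PacketLogVolumes.lean`
# (abc-iut cell, layer L6, slice [IUTchIII] §3; archimedean sibling of `PacketLogVolumesLogLink.lean`)

S. Mochizuki, *Inter-universal Teichmüller theory III*, kurims manuscript (May 2020), §3, Proposition 3.9 (iv)
(b), p. 117 [claim: Mochizuki2012, status: disputed]: "At the level of the `ℚ`-spans of log-shells '`𝓘^ℚ((−))`'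
that arise from the various `𝓕`-prime-strips involved, the log-volumes of (a) indexed by `(n, m)` are
compatible — in the sense discussed in Propositions 1.2, (iii); 1.3, (iii) — with the corresponding
log-volumes indexed by `(n, m−1)`, relative to the log-link `^{n,m−1}𝓗𝓣 →^{log} ^{n,m}𝓗𝓣`", where Proposition
1.2 (iii) p. 31 reads, at an archimedean place: "At `v ∈ 𝕍^arc`, the diagram (∗^arc) is compatible with the
natural angular log-volume [cf. Remark 1.2.1, (i), below; [AbsTopIII], Proposition 5.7, (ii); [AbsTopIII],
Corollary 5.10, (ii)] on `Ψ^×_{†𝓕_v}` and the natural radial log-volume [cf. [AbsTopIII], Proposition 5.7,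
(ii), (c); [AbsTopIII], Corollary 5.10, (ii)] on `Ψ^gp_{log(†𝓕_v)}`", and Remark 3.9.6 p. 145: the
compatibility "amounts to a coincidence of log-volumes — not of arbitrary regions that appear in the domain and
codomain of the log-link, but rather — of certain types of 'sufficiently small' regions".

abc-iut-L6-t4's statement file types (iv)(a) as the datum `Prop39iv_a X` of a log-volume on the regions of
each `(n, m)`-indexed copy and (iv)(b) as the predicate `Prop39iv_b X vol lg Adm` over the partial map `lg`
underlying the log-link `(n, m−1) → (n, m)` and the class `Adm` of admissible ("sufficiently small") regions
(`PacketLogVolumes.lean`, p404053). Its NONARCHIMEDEAN instance over the genuine `p`-adic logarithm is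
`prop39iv_b_unitLog` (`PacketLogVolumesLogLink.lean`, abc-iut-L6-t4, p410652). THIS FILE discharges (b) at
ONE ARCHIMEDEAN PLACE over the genuine complex exponential ([IUTchIII] Def. 1.1 (ii) p. 25: at `v ∈ 𝕍^arc`
the log-link relates `Ψ^gp_{†𝓕_v}` (`k ≅ ℂ` with its units `𝒪^×_k = S¹`) to the universal covering
`Ψ^∼_{†𝓕_v} ↠ Ψ^gp_{†𝓕_v}` (again `≅ ℂ`, the covering map being `exp`), which carries the new field structure
and the log-shell `𝓘 = {|a| ≤ π}`):

* data: carriers `X n m := ℂ` for every lattice position (`Ψ^gp` at `(n, m−1)`, `Ψ^∼ = Ψ^gp_{log}` at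
  `(n, m)`); the log-link map `lg n m u := some (Complex.log u)` on the units `‖u‖ = 1` and undefined
  (`none`) elsewhere — the PRINCIPAL branch as the model's single-valued inverse of the covering map on the
  units (the convention of `VerticallyCoricLGPArch.lean`; Def. 1.1 (ii), Rmk. 1.1.1 (i): the log-link is
  defined on the units); the log-volume `vol n m` := the natural log-volume of [AbsTopIII] Prop. 5.7 (ii)
  (abc-iut-L4-t3 `LocalVolumesArchimedean.lean`): the ANGULAR log-volume `μ̆^log_k` on regions of units
  (subsets of `𝒪^×_k = S¹`) and the RADIAL log-volume `μ^log_k` on all other regions (Prop. 1.2 (iii):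
  "angular log-volume … on `Ψ^×`", "radial log-volume … on `Ψ^gp_{log}`"); the admissible regions `Adm n m`
  := the regions `S` of units whose principal-logarithm image `log(S) ⊆ iℝ` lies in the class `M(k)` of
  [AbsTopIII] Prop. 5.7 (ii) (`ComplexVolume.radialAdmissible`: nonempty, compact, radial projection the
  closure of its interior) with `pr_ℝ` injective on it — exactly the hypotheses of [AbsTopIII] Prop. 5.7
  (ii)(c) ("sufficiently small", Rmk. 3.9.6);
* **`prop39iv_b_arch`** — `Prop39iv_b` HOLDS for this data: the set of values of `lg` on `S ∈ Adm` is
  `log(S)` (`lgImage_eq_image_clog`), `exp(log(S)) = S`, and `μ^log_k(log S) = μ̆^log_k(S)` is abc-iut-L4-t8's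
  discharge `ComplexVolume.ExpLogVolumeCompatible_holds` of [AbsTopIII] Prop. 5.7 (ii)(c)
  (`LocalVolumesArchimedeanProofs.lean`);
* NON-VACUITY: every closed arc `{e^{iθ} | θ ∈ [a, b]}` with `0 < a < b < π` is admissible (`arc_mem_admArch`),
  and for it both sides of the compatibility equal `log (b − a)` (`angularLogVolume_arc`).

No new definitions (the data are written in-line); classical one-variable complex analysis only; nothing here
bears on the disputed [IUTchIII] Cor. 3.12 or takes a side; typed ≠ discharged elsewhere.
-/

noncomputable section

namespace Literature.IUT.LogThetaLattice

open Set Metric Complex Literature.AnabelianGeometry.AbsoluteAnabelian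
open Literature.AnabelianGeometry.AbsoluteAnabelian.ComplexVolume

/-! ### The values of the archimedean log-link on a region of units -/

open Classical in
/-- The set of values of the partial log-link map (principal logarithm on the units `𝒪^×_k = S¹`, undefined
elsewhere) on a region `S` of UNITS is `log(S)` ([IUTchIII] Def. 1.1 (ii) p. 25, Rmk. 1.1.1 (i): the log-link
is defined on the units). [claim: Mochizuki2012, status: disputed] -/
theorem lgImage_eq_image_clog {S : Set ℂ} (hS : S ⊆ sphere (0 : ℂ) 1) :
    {y : ℂ | ∃ x ∈ S, (if ‖x‖ = 1 then some (Complex.log x) else none) = some y} = Complex.log '' S := by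
  ext y
  simp only [Set.mem_setOf_eq, Set.mem_image]
  constructor
  · rintro ⟨x, hx, h⟩
    have hx1 : ‖x‖ = 1 := mem_sphere_zero_iff_norm.mp (hS hx)
    rw [if_pos hx1] at h
    exact ⟨x, hx, Option.some.inj h⟩
  · rintro ⟨x, hx, rfl⟩
    have hx1 : ‖x‖ = 1 := mem_sphere_zero_iff_norm.mp (hS hx)
    exact ⟨x, hx, by rw [if_pos hx1]⟩

/-- On a region of units, `exp ∘ log = id`: the covering map `Ψ^∼ ↠ Ψ^gp` ([IUTchIII] Def. 1.1 (ii)) carries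
the principal-logarithm image of `S ⊆ 𝒪^×_k` back onto `S`. [claim: Mochizuki2012, status: disputed] -/
theorem exp_image_clog_image {S : Set ℂ} (hS : S ⊆ sphere (0 : ℂ) 1) :
    Complex.exp '' (Complex.log '' S) = S := by
  rw [Set.image_image]
  have h : ∀ x ∈ S, Complex.exp (Complex.log x) = x := fun x hx =>
    Complex.exp_log (by
      have hx1 : ‖x‖ = 1 := mem_sphere_zero_iff_norm.mp (hS hx)
      intro h0
      rw [h0, norm_zero] at hx1
      exact zero_ne_one hx1)
  rw [Set.image_congr h, Set.image_id']

/-- The covering map is injective on a principal-logarithm image (`log` is a section of `exp`).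
[claim: Mochizuki2012, status: disputed] -/
theorem injOn_exp_clog_image {S : Set ℂ} (hS : S ⊆ sphere (0 : ℂ) 1) :
    Set.InjOn Complex.exp (Complex.log '' S) := by
  rintro _ ⟨x, hx, rfl⟩ _ ⟨y, hy, rfl⟩ h
  have hx0 : x ≠ 0 := fun h0 => by
    have := mem_sphere_zero_iff_norm.mp (hS hx); rw [h0, norm_zero] at this; exact zero_ne_one this
  have hy0 : y ≠ 0 := fun h0 => by
    have := mem_sphere_zero_iff_norm.mp (hS hy); rw [h0, norm_zero] at this; exact zero_ne_one this
  rw [Complex.exp_log hx0, Complex.exp_log hy0] at h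
  rw [h]

/-- A region in the class `M(k)` of [AbsTopIII] Prop. 5.7 (ii) (nonempty, radial projection the closure of
its interior) is never a region of units: its radial projection has nonempty interior, whereas a subset of
`S¹` projects to `{1}`. (So the combined log-volume below evaluates such a region by the RADIAL log-volume.)
[cite: MochizukiAbsTopIII2015, Prop 5.7 (ii) p. 138] -/
theorem not_subset_sphere_of_mem_radialAdmissible {A : Set ℂ} (hA : A ∈ radialAdmissible) :
    ¬ A ⊆ sphere (0 : ℂ) 1 := by
  intro hAs
  obtain ⟨hne, -, hcl⟩ := hA
  -- the radial projection of a region of units is `{1}`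
  have himg : ((‖·‖) '' A : Set ℝ) = {1} := by
    apply Set.Subset.antisymm
    · rintro _ ⟨a, ha, rfl⟩
      exact mem_sphere_zero_iff_norm.mp (hAs ha)
    · intro r hr
      rw [Set.mem_singleton_iff] at hr
      subst hr
      obtain ⟨a, ha⟩ := hne
      exact ⟨a, ha, mem_sphere_zero_iff_norm.mp (hAs ha)⟩
  rw [himg, interior_singleton, closure_empty] at hcl
  exact (Set.singleton_nonempty (1 : ℝ)).ne_empty hcl.symm

/-! ### Proposition 3.9 (iv) (b) at an archimedean place -/

open Classical in
/-- **IUTchIII:Prop3.9(iv)(b)** (kurims p. 117; Prop. 1.2 (iii) p. 31; Rmk. 3.9.6 p. 145) at ONE ARCHIMEDEAN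
place, UNCONDITIONALLY at the genuine complex exponential: abc-iut-L6-t4's `Prop39iv_b` HOLDS for the carriers
`X n m := ℂ` (`Ψ^gp` at `(n, m−1)`, its universal covering `Ψ^∼` at `(n, m)`, Def. 1.1 (ii)), the log-volume
`vol` := the angular log-volume `μ̆^log_k` on regions of units and the radial log-volume `μ^log_k` on all other
regions ([AbsTopIII] Prop. 5.7 (ii); Prop. 1.2 (iii): "angular log-volume … on `Ψ^×`" and "radial log-volume …
on `Ψ^gp_{log}`"), the log-link map `lg` := the principal logarithm on the units (undefined elsewhere), and the
admissible ("sufficiently small", Rmk. 3.9.6) regions := the regions `S ⊆ 𝒪^×_k` whose principal-logarithm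
image lies in `M(k)` with `pr_ℝ` injective on it ([AbsTopIII] Prop. 5.7 (ii)(c)): "the log-volumes … indexed
by `(n, m)` are compatible … with the corresponding log-volumes indexed by `(n, m−1)`, relative to the
log-link" — via abc-iut-L4-t8's `ComplexVolume.ExpLogVolumeCompatible_holds`.
[claim: Mochizuki2012, status: disputed] -/
theorem prop39iv_b_arch :
    Prop39iv_b (fun _ _ : ℤ => ℂ)
      (fun _ _ A => if A ⊆ sphere (0 : ℂ) 1 then angularLogVolume A else radialLogVolume A)
      (fun _ _ x => if ‖x‖ = 1 then some (Complex.log x) else none)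
      (fun _ _ => {S | S ⊆ sphere (0 : ℂ) 1 ∧ Complex.log '' S ∈ radialAdmissible ∧
        Set.InjOn (‖·‖) (Complex.log '' S)}) := by
  intro n m S hS
  obtain ⟨hSU, hA, hinjN⟩ := hS
  dsimp only
  rw [lgImage_eq_image_clog hSU, if_neg (not_subset_sphere_of_mem_radialAdmissible hA), if_pos hSU]
  have hexp : Complex.exp '' (Complex.log '' S) ⊆ sphere (0 : ℂ) 1 := by
    rw [exp_image_clog_image hSU]; exact hSU
  have h := ExpLogVolumeCompatible_holds _ hA hexp hinjN (injOn_exp_clog_image hSU)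
  rwa [exp_image_clog_image hSU] at h

open Classical in
/-- **IUTchIII:Prop3.9(iv)(a)** (kurims p. 117: "the log-volumes … determine log-volumes on the various
`𝓘^ℚ((−))`") is the DATUM `vol : Prop39iv_a X` itself — here the natural archimedean log-volume at every lattice
position; on a region of the class `M(k)` (in particular on every region of a log-shell with nonempty radial
interior) it evaluates to the RADIAL log-volume `μ^log_k`. [claim: Mochizuki2012, status: disputed] -/
theorem prop39iv_a_arch_eval (n m : ℤ) (A : Set ℂ) (hA : A ∈ radialAdmissible) :
    (fun (_ _ : ℤ) (B : Set ℂ) =>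
        if B ⊆ sphere (0 : ℂ) 1 then angularLogVolume B else radialLogVolume B : Prop39iv_a (fun _ _ : ℤ => ℂ))
      n m A = radialLogVolume A := by
  dsimp only
  rw [if_neg (not_subset_sphere_of_mem_radialAdmissible hA)]

/-! ### Non-vacuity: closed arcs in the open upper half-circle are admissible -/

/-- The closed arc `{e^{iθ} | θ ∈ [a, b]}` is a region of units (`⊆ 𝒪^×_k = S¹`).
[claim: Mochizuki2012, status: disputed] -/
theorem arc_subset_sphere (a b : ℝ) :
    (fun θ : ℝ => Complex.exp (θ * I)) '' Set.Icc a b ⊆ sphere (0 : ℂ) 1 := by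
  rintro _ ⟨θ, -, rfl⟩
  exact mem_sphere_zero_iff_norm.mpr (Complex.norm_exp_ofReal_mul_I θ)

/-- The principal logarithm of the arc `{e^{iθ} | θ ∈ [a, b]}`, `0 < a`, `b < π`, is the segment `i·[a, b]`.
[claim: Mochizuki2012, status: disputed] -/
theorem clog_image_arc {a b : ℝ} (ha : 0 < a) (hb : b < Real.pi) :
    Complex.log '' ((fun θ : ℝ => Complex.exp (θ * I)) '' Set.Icc a b) =
      (fun θ : ℝ => (θ : ℂ) * I) '' Set.Icc a b := by
  rw [Set.image_image]
  refine Set.image_congr fun θ hθ => ?_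
  have him : ((θ : ℂ) * I).im = θ := by simp
  have h1 : -Real.pi < ((θ : ℂ) * I).im := by rw [him]; linarith [hθ.1, Real.pi_pos]
  have h2 : ((θ : ℂ) * I).im ≤ Real.pi := by rw [him]; linarith [hθ.2]
  exact Complex.log_exp h1 h2

/-- The radial projection of the segment `i·[a, b]`, `0 < a`, is `[a, b]`. [claim: Mochizuki2012, status: disputed] -/
theorem norm_image_segment {a b : ℝ} (ha : 0 < a) :
    ((‖·‖) '' ((fun θ : ℝ => (θ : ℂ) * I) '' Set.Icc a b) : Set ℝ) = Set.Icc a b := by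
  rw [Set.image_image]
  have h : ∀ θ ∈ Set.Icc a b, ‖(θ : ℂ) * I‖ = θ := fun θ hθ => by
    rw [norm_mul, Complex.norm_I, mul_one, Complex.norm_real, Real.norm_eq_abs,
      abs_of_pos (lt_of_lt_of_le ha hθ.1)]
  rw [Set.image_congr h, Set.image_id']

/-- **Non-vacuity of the admissible class** ("sufficiently small" regions, [IUTchIII] Rmk. 3.9.6): for
`0 < a < b < π` the closed arc `{e^{iθ} | θ ∈ [a, b]}` is a region of units whose principal-logarithm image
`i·[a, b]` lies in `M(k)` with `pr_ℝ` injective on it. [claim: Mochizuki2012, status: disputed] -/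
theorem arc_mem_admArch {a b : ℝ} (ha : 0 < a) (hab : a < b) (hb : b < Real.pi) :
    (fun θ : ℝ => Complex.exp (θ * I)) '' Set.Icc a b ∈
      {S : Set ℂ | S ⊆ sphere (0 : ℂ) 1 ∧ Complex.log '' S ∈ radialAdmissible ∧
        Set.InjOn (‖·‖) (Complex.log '' S)} := by
  refine ⟨arc_subset_sphere a b, ?_, ?_⟩
  · rw [clog_image_arc ha hb]
    refine ⟨⟨(a : ℂ) * I, a, Set.left_mem_Icc.mpr hab.le, rfl⟩, ?_, ?_⟩
    · exact (isCompact_Icc.image (Complex.continuous_ofReal.mul continuous_const))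
    · rw [norm_image_segment ha, interior_Icc, closure_Ioo hab.ne]
  · rw [clog_image_arc ha hb]
    rintro _ ⟨θ, hθ, rfl⟩ _ ⟨θ', hθ', rfl⟩ h
    have e1 : ‖(θ : ℂ) * I‖ = θ := by
      rw [norm_mul, Complex.norm_I, mul_one, Complex.norm_real, Real.norm_eq_abs,
        abs_of_pos (lt_of_lt_of_le ha hθ.1)]
    have e2 : ‖(θ' : ℂ) * I‖ = θ' := by
      rw [norm_mul, Complex.norm_I, mul_one, Complex.norm_real, Real.norm_eq_abs,
        abs_of_pos (lt_of_lt_of_le ha hθ'.1)]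
    have hθθ' : θ = θ' := by
      have h' : ‖(θ : ℂ) * I‖ = ‖(θ' : ℂ) * I‖ := h
      rwa [e1, e2] at h'
    rw [hθθ']

/-- The radial log-volume of the segment `i·[a, b]` (`0 < a ≤ b`) is `log (b − a)`.
[cite: MochizukiAbsTopIII2015, Prop 5.7 (ii)(a) p. 138] -/
theorem radialLogVolume_segment {a b : ℝ} (ha : 0 < a) (hab : a ≤ b) :
    radialLogVolume ((fun θ : ℝ => (θ : ℂ) * I) '' Set.Icc a b) = Real.log (b - a) := by
  rw [radialLogVolume, radialVolume, norm_image_segment ha, Real.volume_Icc,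
    ENNReal.toReal_ofReal (sub_nonneg.mpr hab)]

/-- **Both sides of the compatibility, computed** for the arc `{e^{iθ} | θ ∈ [a, b]}`, `0 < a < b < π`: the
angular log-volume of the arc (the `(n, m−1)`-side, a region of units) equals `log (b − a)`, the radial
log-volume of its image `i·[a, b]` under the log-link (the `(n, m)`-side) — an instance of `prop39iv_b_arch`.
[claim: Mochizuki2012, status: disputed] -/
theorem angularLogVolume_arc {a b : ℝ} (ha : 0 < a) (hab : a < b) (hb : b < Real.pi) :
    angularLogVolume ((fun θ : ℝ => Complex.exp (θ * I)) '' Set.Icc a b) = Real.log (b - a) := by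
  classical
  have h := prop39iv_b_arch 0 0 _ (arc_mem_admArch ha hab hb)
  dsimp only at h
  rw [lgImage_eq_image_clog (arc_subset_sphere a b), if_pos (arc_subset_sphere a b),
    if_neg (not_subset_sphere_of_mem_radialAdmissible (arc_mem_admArch ha hab hb).2.1),
    clog_image_arc ha hb, radialLogVolume_segment ha hab.le] at h
  exact h.symm

end Literature.IUT.LogThetaLattice

end
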